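import Mathlib
import Summits.ValiantsHypothesis.ValiantsHypothesis.Theorems.LacunarySymmetroidMatrixDescartesDoorA26WallBubblingBubblingTwistedRolle
import Summits.ValiantsHypothesis.ValiantsHypothesis.Theorems.LacunarySymmetroidMatrixDescartesDoorA26WallBubblingBubblingClusters
import Summits.ValiantsHypothesis.ValiantsHypothesis.Theorems.LacunarySymmetroidMatrixDescartesDoorA26WallBubblingBubblingConfig

/-!
# The count (B10b) and the composition into obligation (B) (B12) — turnkey helper, val-idea-15

Module of the BUBBLING REDUCTION for obligation (B) `Stmt.stub_bubbling` of the line `Cruxes/DoorA26/Lines/wall_bubbling.lean`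
(stmt-ValiantsHypothesis-19979, `Theses.LacunarySymmetroid.DoorA26`).  Contents: `blockSum_eq_classSum`, `count_absurd` (B10b: a cluster limit in which every cluster keeps an active class is absurd at a pair-sum
coincidence: `20 ≤ ∑_c (|Λ_c| − 1) ≤ |V| − 1 ≤ 19`), `stub_bubbling_of` (B12: cluster-limit data at every closure point ⇒ (B)). [this work]

HONEST FRAMING / PROVENANCE.  Turnkey port of ideator val-idea-15 g1 (crux workfile `Cruxes/DoorA26/Lines/wall_bubbling_Assembly.lean`, commit d4cb61350496, ZERO `sorry`; split into ≤ 400-line modules, one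
namespace `…WallBubbling.Bubbling`, single copies of the definitions), filed by prover seat val-port-4 g1 (val-lit port pool; desk g12 RULING #266 (b), director R166/R168) with `--supports stmt-ValiantsHypothesis-19979 --as helper`.
Mathlib-only mathematics (elementary real analysis, linear algebra, finite combinatorics); nothing here bears on `DoorA26` (OPEN; obligations (W), (M), (R) of the line remain),
on `MatrixDescartes` (stmt-ValiantsHypothesis-18050) or on `VP ≠ VNP`.
-/

-- `Summit.ValiantsHypothesis.ValiantsHypothesis.…` repeats a component by the D-0017 layout
-- (single-conjunct summit), which the `dupNamespace` linter flags; the name is mandated.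
set_option linter.dupNamespace false

namespace Summit.ValiantsHypothesis.ValiantsHypothesis.Theorems.LacunarySymmetroidMatrixDescartes.WallBubbling.Bubbling

/-! # Part VI — the assembly (S3a–c, B10b, B12) -/


open Finset Filter Topology









/-! ## The typed output of the bookkeeping (B4–B7, B11): cluster limits -/




/-- Block sums of the matrix of `H` are the class sums of `H` for the member exponents. [this work] -/
theorem blockSum_eq_classSum (δ : Fin 6 → ℝ) (H : Pair → ℝ) (v : ℝ) :
    (∑ k, ∑ l, if δ k + δ l = v then (Matrix.of fun k l => H (k, l)) k l else 0) = classSum H (pairExp δ) v := by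
  unfold classSum pairExp
  rw [← Finset.sum_product']
  rfl

/-! ## B10b — the count -/

/-- **B10b.**  At a `δ⋆` with a pair-sum coincidence, a cluster limit in which every cluster keeps an active limit
class is absurd: B3 bounds the zeros of cluster `c` by `|Λ_c| − 1`, B8 orders the `Λ_c`, B9 sums to `≤ |V| − 1`, B10a gives
`|V| ≤ 20`, against `∑ m c = 20`. [folklore] -/
theorem count_absurd {δstar : Fin 6 → ℝ} (D : ClusterLimit δstar)
    (hcoin : ∃ i j k l : Fin 6, (i, j) ≠ (k, l) ∧ (i, j) ≠ (l, k) ∧ δstar i + δstar j = δstar k + δstar l)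
    (hact : ∀ c, ∃ w, classSum (D.H c) (pairExp δstar) w ≠ 0) : False := by
  classical
  -- the value set and its size
  set V : Finset ℝ := Finset.univ.image (fun p : Fin 6 × Fin 6 => δstar p.1 + δstar p.2) with hVdef
  have hV : V.card ≤ 20 := card_pairSums_le_twenty δstar hcoin
  -- exponents converge member-wise
  have hx : ∀ p : Pair, Tendsto (fun ν => pairExp (D.δseq ν) p) atTop (𝓝 (pairExp δstar p)) :=
    fun p => (D.hδ p.1).add (D.hδ p.2)
  -- a nonzero class has a member, hence its value lies in `V`
  have hmemV : ∀ c w, classSum (D.H c) (pairExp δstar) w ≠ 0 → w ∈ V := by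
    intro c w hw
    obtain ⟨p, hp, -⟩ := exists_member_of_classSum_ne_zero (D.H c) (pairExp δstar) w hw
    rw [hVdef, Finset.mem_image]
    exact ⟨p, Finset.mem_univ _, hp⟩
  -- the active value sets
  set Λ : Fin D.C → Finset ℝ := fun c => V.filter fun w => classSum (D.H c) (pairExp δstar) w ≠ 0 with hΛdef
  have hΛmem : ∀ c w, w ∈ Λ c ↔ classSum (D.H c) (pairExp δstar) w ≠ 0 := by
    intro c w
    rw [hΛdef, Finset.mem_filter]
    exact ⟨fun h => h.2, fun h => ⟨hmemV c w h, h⟩⟩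
  have hΛsub : ∀ c, Λ c ⊆ V := fun c => Finset.filter_subset _ _
  have hΛne : ∀ c, (Λ c).Nonempty := by
    intro c
    obtain ⟨w, hw⟩ := hact c
    exact ⟨w, (hΛmem c w).mpr hw⟩
  -- (1) per-cluster count, by B3
  have hcount : ∀ c, D.m c + 1 ≤ (Λ c).card := by
    intro c
    have hev := robust_term_count' (D.a c) (fun ν => pairExp (D.δseq ν)) (D.H c) (pairExp δstar) (Λ c)
      (D.ha c) hx (fun w hw => (hΛmem c w).mpr hw) (hact c) (D.R c)
    obtain ⟨ν, hν⟩ := hev.exists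
    obtain ⟨Z, hZcard, hZ⟩ := D.hzeros c ν
    have := hν Z hZ
    omega
  -- (2) monotone ordering of the active sets, by B8 (member-wise)
  have hmono : ∀ c c', c < c' → ∀ w ∈ Λ c, ∀ w' ∈ Λ c', w ≤ w' := by
    intro c c' hcc' w hw w' hw'
    obtain ⟨p, hp, hHp⟩ := exists_member_of_classSum_ne_zero (D.H c) (pairExp δstar) w ((hΛmem c w).mp hw)
    obtain ⟨p', hp', hHp'⟩ := exists_member_of_classSum_ne_zero (D.H c') (pairExp δstar) w' ((hΛmem c' w').mp hw')
    have := tropical_monotone (fun ν => pairExp (D.δseq ν)) (D.a c) (D.a c') (pairExp δstar) (D.H c) (D.H c')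
      (D.L c c') (D.ρ c c') hx (D.ha c) (D.ha c') (D.hbound c) (D.hbound c') (D.hρ c c') (D.hL c c' hcc')
      (D.htransfer c c' hcc') hHp hHp'
    rw [hp, hp'] at this
    exact this
  -- (3) the interval count, by B9
  have hint : ∑ c, ((Λ c).card - 1) ≤ V.card - 1 := interval_count V Λ hΛne hΛsub hmono
  -- (4) arithmetic
  have hsum : ∑ c, D.m c ≤ ∑ c, ((Λ c).card - 1) :=
    Finset.sum_le_sum fun c _ => by have := hcount c; omega
  have h20 := D.hm
  omega

/-! ## B12 — composition into obligation (B) -/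

/-- **B12 composition.**  If every `δ⋆` in the closure of the twenty-locus carries cluster-limit data, obligation (B)
holds: either some cluster blows up — its limit `H c ≠ 0` has all `δ⋆`-block sums zero and is realisable, i.e. it IS the wanted
pattern — or every cluster keeps an active class and `count_absurd` applies. [this work] -/
theorem stub_bubbling_of
    (hS3 : ∀ δstar : Fin 6 → ℝ, δstar ∈ closure TwentyLocus → Nonempty (ClusterLimit δstar)) :
    Stmt.stub_bubbling := by
  intro δstar _ hclos hcoin
  obtain ⟨D⟩ := hS3 δstar hclos
  by_cases hblow : ∃ c, ∀ w, classSum (D.H c) (pairExp δstar) w = 0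
  · obtain ⟨c, hc⟩ := hblow
    refine ⟨Matrix.of fun k l => D.H c (k, l), ?_, ?_, D.hreal c⟩
    · intro hzero
      apply D.hH c
      funext p
      have := congrFun (congrFun hzero p.1) p.2
      simpa using this
    · intro v
      rw [blockSum_eq_classSum]
      exact hc v
  · push Not at hblow
    exact (count_absurd D hcoin hblow).elim

end Summit.ValiantsHypothesis.ValiantsHypothesis.Theorems.LacunarySymmetroidMatrixDescartes.WallBubbling.Bubbling
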